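import Literature.AlgebraicGeometry.HodgeTheory.MonomialSupportedHypersurfaceMonodromy
import Literature.AlgebraicGeometry.HodgeTheory.MonomialSupportedHypersurfaceInvariantCycles
import Literature.AlgebraicGeometry.HodgeTheory.PicardLefschetzNodalForms
import Literature.AlgebraicGeometry.HodgeTheory.SignSymmetricOrbitDataAssembly
import Literature.AlgebraicGeometry.HodgeTheory.BettiUniverseIsoTransport
import HarnessLib

/-!
# K1-B piece PEN, transport kit (route `SignSymmetricPowers`, item stmt-HodgeConjecture-19716): reading a
# Picard–Lefschetz transformation of the universal family at a base point of the ι-even family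

Line `andre-zariski`, skeleton v12d (`23a5bf35595a68b5`); helper file for the registered stub
`stub_signPencilTransvections` (PEN), landed `--supports stmt-HodgeConjecture-19716`.  Notation:
`π : 𝒴_U → U` the universal family of smooth degree-`d` hypersurfaces of `ℙⁿ⁺¹` (`family`), `π_M : 𝒴_M → S_M` the
`M`-supported subfamily (`familyM`), `g_M : S_M → U` (`toBase`), `e_s : 𝒴_{M,s} ≅ 𝒴_{U, g_M s}` (`fiberIsoM`),
`σ_{γ,s}` the fibre maps of the relative diagonal automorphism (`sigmaMFiber`), `B = tr ∘ ∪` the light trace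
forms of the fibres, `T_β` rational transports (`IsRatTransport`).

## What is proved (no facts consumed except as explicit hypotheses of the final lemma's caller)

* §1 `conj_oneParamTransvectionEquiv_of_similitude` — a similitude `φ` (`B'(φx, φy) = μ B(x, y)`, `μ ≠ 0`)
  conjugates `U^B_δ(c)` to `U^{B'}_{φδ}(c/μ)`; `oneParamTransvectionEquiv_mul_apply_of_orthogonal` — the product of
  transvections along orthogonal isotropic centres is `x ↦ x + c B(x,δ₁)δ₁ + c B(x,δ₂)δ₂`;
  `exists_ne_zero_eq_smul_of_finrank_eq_one` (two non-zero functionals on a line are proportional).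
* §2 `bettiCup_ratTransport` — rational transports are multiplicative (`T_p x ∪ T_q y = T_{p+q}(x ∪ y)`,
  from `transportFun_cupProduct`); **`exists_tr_cup_ratTransport_eq_mul`** — along a PATH between smooth projective
  fibres the rational transport is a similitude of the light trace forms, `tr_t(Tx ∪ Ty) = μ · tr_s(x ∪ y)`,
  `μ ≠ 0` (the light trace is normalised independently on each fibre, so `μ = 1` is not available).
* §3 `hypersurfacePoint_map_of_comp_eq_diagonalProjMap`, **`fibrePoint_map_conj_sigmaMFiber`** — the involution of
  the ι-even family moved to the universal fibre, `σ' = e_s⁻¹ ≫ σ_{γ,s} ≫ e_s`, acts as `[z] ↦ [γ • z]` on the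
  homogeneous coordinates `fibrePoint` (the hypothesis shape of `IsEquivariantPicardLefschetzData`).
* §4 **`exists_transport_picardLefschetz`** — THE TRANSPORT LEMMA: if `δ₁…δ_k, c` are Picard–Lefschetz data of the
  universal family for the image `g_M ∘ ω` of a loop `ω` at `s ∈ S_M(ℂ)` (`IsPicardLefschetzData`) and `T` is the
  rational transport of `π_M` along `β · ω · β⁻¹` at `t`, then `T x = x + c' Σᵢ B_t(x, Φδᵢ) Φδᵢ` with `c' ≠ 0`,
  `Φ = T_β⁻¹ ∘ e_s^*` a `B`-similitude (`B_t(Φv, Φw) = ν B(v, w)`, `ν ≠ 0`) intertwining `σ_{γ,t}^*` with `σ'^*`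
  (base change `isRatTransport_familyM_of_family`, conjugation along `β` via `exists_ratTransport` /
  `isRationalClass_transportFun_familyM`, uniqueness by `ofRatClass_injective`, flatness of `σ^*`
  `isRatTransport_map_pull_sigmaMFiber`).

Sorry-free; axioms `propext`, `Classical.choice`, `Quot.sound`; no definition, no named fact.

## References

* [VoisinHodgeII2003] C. Voisin, Hodge Theory and Complex Algebraic Geometry II (CUP 2003), §3.1.2 (local systems,
  monodromy), §3.2.1 Thm. 3.16, §3.2.2 (construction of `δ_γ` by transport), §3.2.3, §6.2.1.
* [ArnoldGuseinzadeVarchenko2012] Arnold, Gusein-Zade, Varchenko, Singularities of Differentiable Maps II, Part I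
  §1.3, §5.1.
* [Deligne1980] P. Deligne, La conjecture de Weil II, Publ. Math. IHÉS 52 (1980), §4.4 (transvections).
* [Katz2009] N. M. Katz, Another look at the Dwork family (2009), §3.
* [HatcherAT2002] A. Hatcher, Algebraic Topology (CUP 2002), §3.3 Thm. 3.26.
-/

noncomputable section

set_option linter.dupNamespace false

open CategoryTheory AlgebraicGeometry
open scoped LinearAlgebra.Projectivization
open Literature.AlgebraicTopology.SingularHomology
open Literature.AlgebraicGeometry.Motives Literature.AlgebraicGeometry.Motives.UniversalHypersurface
open Literature.AlgebraicGeometry.HodgeTheory Literature.AlgebraicGeometry.HodgeTheory.UniversalHypersurface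
open Literature.AlgebraicGeometry.HodgeTheory.BettiUniverse

namespace Summit.HodgeConjecture.HodgeConjecture.Theorems.SignSymmetricPowersPencilTransport

/-! ### §1 Transvections under similitudes -/

section Algebra

variable {K V W : Type*} [Field K] [AddCommGroup V] [Module K V] [AddCommGroup W] [Module K W]

/-- **A similitude conjugates a transvection to a transvection**: if `φ : V ≃ W` satisfies
`B'(φ x, φ y) = μ · B(x, y)` with `μ ≠ 0`, then `φ ∘ U^B_δ(c) ∘ φ⁻¹ = U^{B'}_{φ δ}(c/μ)` — in Mathlib's
composition order `φ.symm ≪≫ U ≪≫ φ`. [cite: Deligne1980, §4.4 Lemme (4.4.2^α) p. 227] -/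
theorem conj_oneParamTransvectionEquiv_of_similitude (B : LinearMap.BilinForm K V)
    (B' : LinearMap.BilinForm K W) (φ : V ≃ₗ[K] W) {μ : K} (hμ : μ ≠ 0)
    (hφ : ∀ x y, B' (φ x) (φ y) = μ * B x y) {δ : V} (hδ : B δ δ = 0) (c : K) :
    φ.symm ≪≫ₗ oneParamTransvectionEquiv B hδ c ≪≫ₗ φ =
      oneParamTransvectionEquiv B' (δ := φ δ)
        (by rw [hφ, hδ, mul_zero]) (c * μ⁻¹) := by
  refine LinearEquiv.ext fun w ↦ ?_
  rw [LinearEquiv.trans_apply, LinearEquiv.trans_apply, oneParamTransvectionEquiv_apply,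
    oneParamTransvectionEquiv_apply, map_add, LinearEquiv.apply_symm_apply, map_smul]
  congr 2
  have h := hφ (φ.symm w) δ
  rw [LinearEquiv.apply_symm_apply] at h
  rw [h]
  field_simp

/-- The product of two COMMUTING-ORDER transvections along `B`-orthogonal centres is the two-centre
Picard–Lefschetz map `x ↦ x + c B(x, δ₁) δ₁ + c B(x, δ₂) δ₂`. [cite: VoisinHodgeII2003, §3.2.1 Thm. 3.16] -/
theorem oneParamTransvectionEquiv_mul_apply_of_orthogonal (B : LinearMap.BilinForm K V) {δ₁ δ₂ : V}
    (h₁ : B δ₁ δ₁ = 0) (h₂ : B δ₂ δ₂ = 0) (h₂₁ : B δ₂ δ₁ = 0) (c : K) (x : V) :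
    (oneParamTransvectionEquiv B h₁ c * oneParamTransvectionEquiv B h₂ c) x =
      x + (c * B x δ₁) • δ₁ + (c * B x δ₂) • δ₂ := by
  rw [LinearEquiv.mul_apply, oneParamTransvectionEquiv_apply, oneParamTransvectionEquiv_apply, map_add,
    LinearMap.add_apply, map_smul, LinearMap.smul_apply, h₂₁, smul_eq_mul, mul_zero, add_zero]
  abel

/-- Two non-zero linear functionals on a line are proportional by a non-zero scalar. [folklore] -/
theorem exists_ne_zero_eq_smul_of_finrank_eq_one (h1 : Module.finrank K V = 1) (φ ψ : V →ₗ[K] K)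
    (hφ : φ ≠ 0) (hψ : ψ ≠ 0) : ∃ c : K, c ≠ 0 ∧ φ = c • ψ := by
  obtain ⟨v, hv⟩ := DFunLike.ne_iff.1 hψ
  rw [LinearMap.zero_apply] at hv
  have hv0 : v ≠ 0 := fun h ↦ hv (by rw [h, map_zero])
  have hc : φ = (φ v / ψ v) • ψ := by
    refine LinearMap.ext fun w ↦ ?_
    obtain ⟨a, rfl⟩ := (finrank_eq_one_iff_of_nonzero' v hv0).1 h1 w
    rw [LinearMap.smul_apply, map_smul, map_smul, smul_eq_mul, smul_eq_mul, smul_eq_mul]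
    field_simp
  refine ⟨φ v / ψ v, ?_, hc⟩
  intro h0
  exact hφ (by rw [hc, h0, zero_smul])

end Algebra

/-! ### §2 Rational transport along a path is a similitude of the trace forms -/

section Path

variable {𝒳 S : SchemeOver ℂ} (f : 𝒳 ⟶ S) {U : Set (ComplexPoints S)}
  (hU : IsCohomologicallyLocallyTrivialOn f U)

/-- **Rational transports are multiplicative**: if `Tp`, `Tq`, `Tr` are the rational transports along one
path class `γ` in degrees `p`, `q`, `p + q = r`, then `Tp x ∪ Tq y = Tr (x ∪ y)` (transport of `R• f_* ℂ`
is multiplicative, `transportFun_cupProduct`, and `Hᵏ(–; ℚ) ↪ Hᵏ(–; ℂ)`). [cite: VoisinHodgeII2003, §3.1.2] -/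
theorem bettiCup_ratTransport {s t : U} (γ : Path.Homotopic.Quotient s t) {p q r : ℕ} (h : p + q = r)
    {Tp : bettiCohomology (fiberOver f s.1) p ≃ₗ[ℚ] bettiCohomology (fiberOver f t.1) p}
    {Tq : bettiCohomology (fiberOver f s.1) q ≃ₗ[ℚ] bettiCohomology (fiberOver f t.1) q}
    {Tr : bettiCohomology (fiberOver f s.1) r ≃ₗ[ℚ] bettiCohomology (fiberOver f t.1) r}
    (hTp : IsRatTransport f p hU γ Tp) (hTq : IsRatTransport f q hU γ Tq) (hTr : IsRatTransport f r hU γ Tr)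
    (x : bettiCohomology (fiberOver f s.1) p) (y : bettiCohomology (fiberOver f s.1) q) :
    bettiCup h (Tp x) (Tq y) = Tr (bettiCup h x y) := by
  have hrat : ∀ {Z : SchemeOver ℂ} (a : bettiCohomology Z p) (b : bettiCohomology Z q),
      ofRatClass (ComplexPoints Z) r (bettiCup h a b) = cupProduct h (ofRatClass _ p a) (ofRatClass _ q b) :=
    fun a b ↦ by
      rw [ofRatClass_eq_ringChange, ofRatClass_eq_ringChange, ofRatClass_eq_ringChange]
      exact singularCohomology.ringChange_cupProduct _ h a b
  apply ofRatClass_injective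
  rw [hrat, hTp x, hTq y, hTr, hrat, transportFun_cupProduct f hU h γ]

/-- **Rational transport along a path is a similitude of the light trace forms**: for smooth projective
`n`-dimensional fibres `X_s`, `X_t` and rational transports `T` (degree `n`) and `T₂ₙ` (degree `2n`) along
one path class from `s` to `t`, there is `μ ≠ 0` with `tr_t(T x ∪ T y) = μ · tr_s(x ∪ y)` for all `x, y`
(`T x ∪ T y = T₂ₙ(x ∪ y)`, and `tr_t ∘ T₂ₙ`, `tr_s` are non-zero functionals on the line `H²ⁿ(X_s(ℂ); ℚ)`).
The scalar `μ` is not `1` in general: the light trace is normalised independently on each fibre.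
[cite: VoisinHodgeII2003, §3.1.2 and §3.2.3] [cite: HatcherAT2002, §3.3 Thm. 3.26] -/
theorem exists_tr_cup_ratTransport_eq_mul {n : ℕ} {s t : U} (hXs : IsSmoothProjective n (fiberOver f s.1))
    (hXt : IsSmoothProjective n (fiberOver f t.1)) (γ : Path.Homotopic.Quotient s t)
    {T : bettiCohomology (fiberOver f s.1) n ≃ₗ[ℚ] bettiCohomology (fiberOver f t.1) n}
    {T₂ : bettiCohomology (fiberOver f s.1) (n + n) ≃ₗ[ℚ] bettiCohomology (fiberOver f t.1) (n + n)}
    (hT : IsRatTransport f n hU γ T) (hT₂ : IsRatTransport f (n + n) hU γ T₂) :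
    ∃ μ : ℚ, μ ≠ 0 ∧ ∀ x y : bettiCohomology (fiberOver f s.1) n,
      tr hXt (n + n) (cup (fiberOver f t.1) n n (T x) (T y)) = μ * tr hXs (n + n) (cup (fiberOver f s.1) n n x y) := by
  have h2n : n + n = 2 * n := (two_mul n).symm
  have hline : Module.finrank ℚ (bettiCohomology (fiberOver f s.1) (n + n)) = 1 := by
    rw [h2n]; exact finrank_bettiCohomology_top hXs
  have htrs : tr hXs (n + n) ≠ 0 := by rw [h2n]; exact tr_top_ne_zero hXs
  have htrt : tr hXt (n + n) ∘ₗ T₂.toLinearMap ≠ 0 := by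
    intro h0
    apply (show tr hXt (n + n) ≠ 0 by rw [h2n]; exact tr_top_ne_zero hXt)
    refine LinearMap.ext fun z ↦ ?_
    have hz := LinearMap.congr_fun h0 (T₂.symm z)
    rw [LinearMap.comp_apply, LinearEquiv.coe_coe, LinearEquiv.apply_symm_apply] at hz
    exact hz
  obtain ⟨μ, hμ, hμe⟩ := exists_ne_zero_eq_smul_of_finrank_eq_one hline _ _ htrt htrs
  refine ⟨μ, hμ, fun x y ↦ ?_⟩
  have h := LinearMap.congr_fun hμe (cup (fiberOver f s.1) n n x y)
  rw [LinearMap.comp_apply, LinearEquiv.coe_coe, LinearMap.smul_apply, smul_eq_mul] at h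
  rw [← h, bettiCup_ratTransport f hU γ rfl hT hT hT₂ x y]

end Path


/-! ### §3 The transported involution of the universal fibre acts diagonally on coordinates -/

section Sigma

variable (n d : ℕ) (M : Set (DegIndex n d)) (γ : Fin (n + 2) → ℂˣ)

/-- If `g ≫ ι = ι ≫ ([z] ↦ [a • z])` for a morphism `ι : Y ⟶ ℙⁿ⁺¹`, then `g` acts as `[z] ↦ [a • z]` on the
homogeneous coordinates `hypersurfacePoint ι`. [cite: Katz2009, §3] -/
theorem hypersurfacePoint_map_of_comp_eq_diagonalProjMap {Y : SchemeOver ℂ}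
    (ι : Y ⟶ projectiveSpace (n + 1) ℂ) (g : Y ⟶ Y) (a : Fin (n + 2) → ℂˣ)
    (hg : g ≫ ι = ι ≫ diagonalProjMap a) (x : ComplexPoints Y) :
    hypersurfacePoint ι (AlgPoints.map g x) =
      Projectivization.mk ℂ (a • (hypersurfacePoint ι x).rep)
        ((smul_ne_zero_iff_ne a).mpr (Projectivization.rep_nonzero _)) := by
  refine hypersurfacePoint_eq_of_projPoint_eq _ _ ?_
  rw [← map_diagonalProjMap_projPoint a _ (Projectivization.rep_nonzero _), Projectivization.mk_rep,
    projPoint_hypersurfacePoint]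
  change _ = (AlgPoints.map ι ∘ AlgPoints.map g) x
  rw [← AlgPoints.map_comp, hg, AlgPoints.map_comp, Function.comp_apply]

/-- **The involution of the ι-even family, moved to the universal fibre, acts diagonally on coordinates**:
for `s ∈ S_M(ℂ)` and the base-change isomorphism `e_s : 𝒴_{M,s} ≅ 𝒴_{U, g_M s}` (`fiberIsoM`), the morphism
`σ' := e_s⁻¹ ≫ σ_{γ,s} ≫ e_s` of the universal fibre satisfies
`fibrePoint (σ' x) = [γ • fibrePoint x]` — the shape in which `IsEquivariantPicardLefschetzData` quantifies
over symmetries. [cite: Katz2009, §3] -/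
theorem fibrePoint_map_conj_sigmaMFiber (hγ : FixesMonomials ℂ n d M γ) (s : ComplexPoints (baseM ℂ n d M))
    (x : ComplexPoints (fiberOver (family ℂ n d) (AlgPoints.map (toBase ℂ n d M) s))) :
    fibrePoint n d (AlgPoints.map (toBase ℂ n d M) s)
        (AlgPoints.map ((fiberIsoM ℂ n d M s).inv ≫ sigmaMFiber ℂ n d M γ hγ s ≫ (fiberIsoM ℂ n d M s).hom) x) =
      Projectivization.mk ℂ (γ • (fibrePoint n d (AlgPoints.map (toBase ℂ n d M) s) x).rep)
        ((smul_ne_zero_iff_ne γ).mpr (Projectivization.rep_nonzero _)) := by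
  rw [fibrePoint_def]
  refine hypersurfacePoint_map_of_comp_eq_diagonalProjMap n _ _ γ ?_ x
  have h1 := fiberIsoM_hom_toProjectiveSpace ℂ n d M s
  rw [Category.assoc, Category.assoc, h1, fiberToProjectiveSpace, sigmaMFiber_comp_fiberι_assoc,
    sigmaM_comp_toProjectiveSpace, ← diagProjMap_eq_diagonalProjMap]
  rw [← Category.assoc (fiberι (familyM ℂ n d M) s), ← Category.assoc (fiberι (familyM ℂ n d M) s ≫ _),
    Category.assoc (fiberι (familyM ℂ n d M) s)]
  change (fiberIsoM ℂ n d M s).inv ≫ fiberToProjectiveSpace ℂ n d M s ≫ diagProjMap ℂ n γ = _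
  rw [← h1]
  simp only [Category.assoc, Iso.inv_hom_id_assoc]

end Sigma

/-! ### §4 The transport lemma: a Picard–Lefschetz transformation of the universal family, read at a base
point of the ι-even family -/

section Transport

variable (n d : ℕ) (M : Set (DegIndex n d)) (γ : Fin (n + 2) → ℂˣ)

/-- **Transport lemma.** Let `n, d ≥ 1`, `γ` fix the monomials of `M`, `t, s ∈ S_M(ℂ)`, `β` a path from
`t` to `s`, `ω` a loop at `s`, and let `δ₁, …, δ_k ∈ Hⁿ(𝒴_{U, g_M s}; ℚ)`, `c ∈ ℚ` be Picard–Lefschetz data of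
the universal family for the image loop `g_M ∘ ω` (`IsPicardLefschetzData`: the rational transport along it is
`x ↦ x + c Σᵢ B(x, δᵢ) δᵢ`).  If `T` is the rational transport of `familyM` along `β · ω · β⁻¹` at `t`, then
there are `c' ≠ 0` and a linear map `Φ : Hⁿ(𝒴_{U, g_M s}; ℚ) → Hⁿ(𝒴_{M,t}; ℚ)` (namely
`Φ = T_β⁻¹ ∘ e_s^*`, `e_s = fiberIsoM s`, `T_β` the rational transport along `β`) with
`T x = x + c' Σᵢ B_t(x, Φ δᵢ) Φ δᵢ`, `B_t(Φ v, Φ w) = ν · B(v, w)` for one `ν ≠ 0`, and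
`σ_{γ,t}^* (Φ v) = Φ (σ'^* v)` for `σ' = e_s⁻¹ ≫ σ_{γ,s} ≫ e_s` (base change
`isRatTransport_familyM_of_family`, conjugation along `β`, uniqueness of rational transport, the similitude
scalars of `exists_tr_comp_pull_eq_mul_of_iso` / `exists_tr_cup_ratTransport_eq_mul`, and
`isRatTransport_map_pull_sigmaMFiber`). [cite: VoisinHodgeII2003, §3.1.2 and §3.2.2 (construction of δ_γ by transport)] -/
theorem exists_transport_picardLefschetz (hn : 1 ≤ n) (hd : 1 ≤ d) (hγ : FixesMonomials ℂ n d M γ)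
    (hUU : IsCohomologicallyLocallyTrivialOn (family ℂ n d) Set.univ)
    (hU : IsCohomologicallyLocallyTrivialOn (familyM ℂ n d M) Set.univ)
    {t s : ComplexPoints (baseM ℂ n d M)} (β : Path t s) (ω : Path s s) {k : ℕ}
    {δ : Fin k → bettiCohomology (fiberOver (family ℂ n d) (AlgPoints.map (toBase ℂ n d M) s)) n} {c : ℚ}
    (hPL : IsPicardLefschetzData n d k hn hd hUU (ω.map (AlgPoints.mapContinuous (toBase ℂ n d M)).continuous) δ c)
    {T : bettiCohomology (fiberOver (familyM ℂ n d M) t) n ≃ₗ[ℚ] bettiCohomology (fiberOver (familyM ℂ n d M) t) n}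
    (hT : IsRatTransport (familyM ℂ n d M) n hU ⟦((β.trans ω).trans β.symm).map
      (⟨fun s => ⟨s, Set.mem_univ s⟩, continuous_id.subtype_mk _⟩ : C(ComplexPoints (baseM ℂ n d M), (Set.univ : Set (ComplexPoints (baseM ℂ n d M))))).continuous⟧ T) :
    ∃ (c' : ℚ) (Φ : bettiCohomology (fiberOver (family ℂ n d) (AlgPoints.map (toBase ℂ n d M) s)) n →ₗ[ℚ]
        bettiCohomology (fiberOver (familyM ℂ n d M) t) n),
      c' ≠ 0 ∧
      (∀ x, T x = x + c' • ∑ i,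
        tr (isSmoothProjective_fiberOver_familyM ℂ n d M hn hd t) (n + n)
          (cup (fiberOver (familyM ℂ n d M) t) n n x (Φ (δ i))) • Φ (δ i)) ∧
      (∃ ν : ℚ, ν ≠ 0 ∧ ∀ v w,
        tr (isSmoothProjective_fiberOver_familyM ℂ n d M hn hd t) (n + n)
            (cup (fiberOver (familyM ℂ n d M) t) n n (Φ v) (Φ w)) =
          ν * tr ((isSmoothProjectiveFamily_family ℂ hn hd).isSmoothProjective _) (n + n)
            (cup (fiberOver (family ℂ n d) (AlgPoints.map (toBase ℂ n d M) s)) n n v w)) ∧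
      (∀ v, pull (sigmaMFiber ℂ n d M γ hγ t) n (Φ v) =
        Φ (pull ((fiberIsoM ℂ n d M s).inv ≫ sigmaMFiber ℂ n d M γ hγ s ≫ (fiberIsoM ℂ n d M s).hom) n v)) := by
  -- notation
  set toU : C(ComplexPoints (baseM ℂ n d M), (Set.univ : Set (ComplexPoints (baseM ℂ n d M)))) :=
    ⟨fun s => ⟨s, Set.mem_univ s⟩, continuous_id.subtype_mk _⟩ with htoU
  set e := fiberIsoM ℂ n d M s with he
  have hYt : IsSmoothProjective n (fiberOver (familyM ℂ n d M) t) :=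
    isSmoothProjective_fiberOver_familyM ℂ n d M hn hd t
  have hYs : IsSmoothProjective n (fiberOver (familyM ℂ n d M) s) :=
    isSmoothProjective_fiberOver_familyM ℂ n d M hn hd s
  have hYU : IsSmoothProjective n (fiberOver (family ℂ n d) (AlgPoints.map (toBase ℂ n d M) s)) :=
    (isSmoothProjectiveFamily_family ℂ hn hd).isSmoothProjective _
  have hrat := fun (a b : (Set.univ : Set (ComplexPoints (baseM ℂ n d M)))) (δ' : Path.Homotopic.Quotient a b)
      (α : complexBetti (fiberOver (familyM ℂ n d M) a.1) n) (hα : IsRationalClass α) =>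
    isRationalClass_transportFun_familyM n d M hn hd n hU δ' hα
  have hrat2 := fun (a b : (Set.univ : Set (ComplexPoints (baseM ℂ n d M)))) (δ' : Path.Homotopic.Quotient a b)
      (α : complexBetti (fiberOver (familyM ℂ n d M) a.1) (n + n)) (hα : IsRationalClass α) =>
    isRationalClass_transportFun_familyM n d M hn hd (n + n) hU δ' hα
  -- the Picard–Lefschetz transport of the universal family, moved to `𝒴_{M,s}`
  obtain ⟨TU, hTU, hTUx⟩ := hPL.2.2.1
  have hTM : IsRatTransport (familyM ℂ n d M) n hU ⟦ω.map toU.continuous⟧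
      (pullEquiv e n ≪≫ₗ TU ≪≫ₗ (pullEquiv e n).symm) :=
    isRatTransport_familyM_of_family n d M n hUU hU (ω.map toU.continuous)
      ((ω.map (AlgPoints.mapContinuous (toBase ℂ n d M)).continuous).map (toUniv n d).continuous)
      (fun _ => rfl) hTU
  -- the transport along `β` and the conjugate
  obtain ⟨Tβ, hTβ⟩ : ∃ Tβ, IsRatTransport (familyM ℂ n d M) n hU
      (⟦β.map toU.continuous⟧ : Path.Homotopic.Quotient (toU t) (toU s)) Tβ :=
    exists_ratTransport (familyM ℂ n d M) n hU hrat _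
  obtain ⟨Tβ2, hTβ2⟩ : ∃ Tβ2, IsRatTransport (familyM ℂ n d M) (n + n) hU
      (⟦β.map toU.continuous⟧ : Path.Homotopic.Quotient (toU t) (toU s)) Tβ2 :=
    exists_ratTransport (familyM ℂ n d M) (n + n) hU hrat2 _
  have hT' : IsRatTransport (familyM ℂ n d M) n hU ⟦((β.trans ω).trans β.symm).map toU.continuous⟧
      (Tβ ≪≫ₗ (pullEquiv e n ≪≫ₗ TU ≪≫ₗ (pullEquiv e n).symm) ≪≫ₗ Tβ.symm) := by
    rw [Path.map_trans, Path.map_trans, ← Path.map_symm]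
    exact ((hTβ.trans (familyM ℂ n d M) n hU hTM).trans (familyM ℂ n d M) n hU
      (hTβ.symm (familyM ℂ n d M) n hU))
  -- uniqueness of the rational transport
  have hTT : ∀ x, T x = Tβ.symm (pull e.hom n (TU (pull e.inv n (Tβ x)))) := fun x => by
    exact ofRatClass_injective n ((hT x).trans (hT' x).symm)
  have hTUx' : ∀ y : bettiCohomology (fiberOver (family ℂ n d) (AlgPoints.map (toBase ℂ n d M) s)) n,
      TU y = y + c • ∑ i, tr hYU (n + n)
        (cup (fiberOver (family ℂ n d) (AlgPoints.map (toBase ℂ n d M) s)) n n y (δ i)) • δ i := hTUx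
  -- the similitude scalars
  obtain ⟨lam, hlam, hlame⟩ := exists_tr_comp_pull_eq_mul_of_iso hYU hYs e.symm
  obtain ⟨lam2, hlam2, hlam2e⟩ := exists_tr_comp_pull_eq_mul_of_iso hYs hYU e
  obtain ⟨μ, hμ, hμe⟩ := exists_tr_cup_ratTransport_eq_mul (familyM ℂ n d M) hU (s := toU t)
    (t := toU s) hYt hYs _ hTβ hTβ2
  have hμe' : ∀ a b : bettiCohomology (fiberOver (familyM ℂ n d M) t) n,
      tr hYs (n + n) (cup (fiberOver (familyM ℂ n d M) s) n n (Tβ a) (Tβ b)) =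
        μ * tr hYt (n + n) (cup (fiberOver (familyM ℂ n d M) t) n n a b) := hμe
  have hlame' : ∀ z : bettiCohomology (fiberOver (familyM ℂ n d M) s) (n + n),
      tr hYU (n + n) (pull e.inv (n + n) z) = lam * tr hYs (n + n) z := fun z => hlame (n + n) z
  -- (1) the formula for `T`
  have hform : ∀ x, T x = x + (c * (lam * μ)) • ∑ i, tr hYt (n + n)
      (cup (fiberOver (familyM ℂ n d M) t) n n x (Tβ.symm (pull e.hom n (δ i)))) •
        Tβ.symm (pull e.hom n (δ i)) := fun x => by
    rw [hTT x, hTUx', map_add, map_add, pull_hom_pull_inv_apply, LinearEquiv.symm_apply_apply, map_smul,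
      map_smul, map_sum, map_sum, ← smul_smul c (lam * μ), Finset.smul_sum (r := lam * μ)]
    congr 2
    refine Finset.sum_congr rfl fun i _ => ?_
    rw [map_smul, map_smul, smul_smul]
    congr 1
    set r := Tβ.symm (pull e.hom n (δ i)) with hr
    have h1 : δ i = pull e.inv n (pull e.hom n (δ i)) := (pull_inv_pull_hom_apply e n (δ i)).symm
    have h2 : pull e.hom n (δ i) = Tβ r := by rw [hr, LinearEquiv.apply_symm_apply]
    conv_lhs => rw [h1, ← pull_cup, hlame', h2, hμe']
    ring
  -- (2) `Φ` is a similitude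
  have hsim : ∀ v w, tr hYt (n + n) (cup (fiberOver (familyM ℂ n d M) t) n n (Tβ.symm (pull e.hom n v))
      (Tβ.symm (pull e.hom n w))) = (μ⁻¹ * lam2) * tr hYU (n + n)
        (cup (fiberOver (family ℂ n d) (AlgPoints.map (toBase ℂ n d M) s)) n n v w) := fun v w => by
    have h := hμe' (Tβ.symm (pull e.hom n v)) (Tβ.symm (pull e.hom n w))
    rw [LinearEquiv.apply_symm_apply, LinearEquiv.apply_symm_apply, ← pull_cup, hlam2e] at h
    rw [mul_assoc, h, ← mul_assoc, inv_mul_cancel₀ hμ, one_mul]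
  -- (3) `Φ` intertwines `σ_t^*` with `σ'^*`
  have hequi : ∀ v, pull (sigmaMFiber ℂ n d M γ hγ t) n (Tβ.symm (pull e.hom n v)) =
      Tβ.symm (pull e.hom n (pull (e.inv ≫ sigmaMFiber ℂ n d M γ hγ s ≫ e.hom) n v)) := fun v => by
    have h := isRatTransport_map_pull_sigmaMFiber n d M γ n hU hγ (hTβ.symm (familyM ℂ n d M) n hU)
      (pull e.hom n v)
    rw [pull_comp, pull_comp, LinearMap.comp_apply, LinearMap.comp_apply, pull_hom_pull_inv_apply]
    exact h.symm
  exact ⟨c * (lam * μ), Tβ.symm.toLinearMap ∘ₗ pull e.hom n, mul_ne_zero hPL.1 (mul_ne_zero hlam hμ), hform,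
    ⟨μ⁻¹ * lam2, mul_ne_zero (inv_ne_zero hμ) hlam2, hsim⟩, hequi⟩

end Transport

end Summit.HodgeConjecture.HodgeConjecture.Theorems.SignSymmetricPowersPencilTransport

end
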